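import Literature.Probability.Distributions.GaussianRejectionSampler
import Literature.Computability.Cryptography.PolyTimeComputablePowerSeries
import Literature.Computability.QuantumComplexity.HidingPostMachine
import HarnessLib

/-!
# The arithmetic of the Gaussian rejection sampler is polynomial time (typed `FP` on codes)

Topic `Computability/Cryptography` (the sampler's arithmetic, namespace `GaussRejFP`), with three small rational
bricks added to the `CodeFP` algebra of `Computability/Complexity` (namespace `CodeFP`). The coin-driven
rejection sampler for the discrete Gaussian `D_{ℤ,s,c}` with rational data
(`Probability/Distributions/GaussianRejectionSampler.lean`: acceptance numerator
`accNum θ c s N P x = ⌊2ᴾ · expNegApprox(θ(x-c)²) s N⌋₊`, `expNegApprox y s N = clamp01(taylor(y/2ˢ))^{2ˢ}`,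
`taylorExpNeg z N = ∑_{i<N} (-z)ⁱ/i!`) is the one-dimensional primitive of every lattice reduction of the tree
that samples discrete Gaussians on `ℤ` or on cosets of `q⁻¹ℤ` (GPV's SampleZ; the modulus switch of BLPRS
2013, Lemma 3.5, `Cryptography/LWEModulusSwitch.lean`, pqc.S21). A machine running it evaluates that
arithmetic EXACTLY on codes; this file proves it polynomial time in the typed algebra `CodeFP`
(no machine is written), adding the missing rational bricks on the way:

* bricks (namespace `CodeFP`): `ratLe` / `ratLt` (cross-multiplication, Mathlib's `Rat.le_iff`), `ratMax`,
  `ratMin`, `ratNatFloor` (`⌊q⌋₊ = toNat (num / den)`); rational powers with a unary exponent and factorials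
  are the tree's `PowerSeriesFP.ratPow` (`PolyTimeComputablePowerSeries.lean`) and `natFactorial_codeFP`
  (`QuantumComplexity/HidingPostMachine.lean`);
* **`clamp01_codeFP`**, **`taylorExpNeg_codeFP`** (`(z, 1ᴺ) ↦ ∑_{i<N} (-z)ⁱ/i!`, a `map` over `[0, N)`
  with the exponent read in unary against the budget `N`, then `ratSum`), **`expNegApprox_codeFP`**
  (`((y, 1ˢ), 1ᴺ, 1^{2ˢ}) ↦ expNegApprox y s N`: the `2ˢ`-th power is taken with the UNARY exponent `2ˢ`
  supplied as padding — its exact rational value has `Θ(2ˢ)` digits, which is polynomial in the input only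
  because the input carries `1^{2ˢ}`; the consumer has `2ˢ = poly`), **`accNum_codeFP`**
  (`(record, x) ↦ accNum θ c s N P x` against the record `accCtx = (θ, c, 1ˢ, 1ᴺ, 1ᴾ, 1^{2ˢ})`).

## References

* C. Gentry, C. Peikert, V. Vaikuntanathan, *Trapdoors for hard lattices and new cryptographic constructions*,
  STOC 2008, §4.1 (SampleZ: rejection sampling with acceptance probability `ρ_s(x - c)`)
  [GentryPeikertVaikuntanathan2008].
* D. E. Knuth, *The Art of Computer Programming 2: Seminumerical Algorithms*, 3rd ed., §4.5.1 (rational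
  arithmetic), §4.6.3 (powers) [KnuthTAOCP2].
* S. Arora, B. Barak, *Computational Complexity: A Modern Approach*, CUP 2009, §1.3 (closure of polynomial
  time under composition and polynomially bounded loops) [AroraBarak2009].
-/

namespace Literature.Computability.Complexity

open _root_.Computability

namespace CodeFP

open Brick Polynomial
open Literature.Algebra.EuclideanLattices (encodeRat encodeRat_injective)

/-! ### Order on rational codes -/

/-- **Comparison of rationals on codes** (`≤`, by cross-multiplication). [cite: KnuthTAOCP2, §4.5.1] -/
theorem ratLe : CodeFP (pairE encodeRat encodeRat) bitE (fun p => decide (p.1 ≤ p.2)) := by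
  have ha : CodeFP (pairE encodeRat encodeRat) (pairE intE natE) (fun p => (p.1.num, p.1.den)) :=
    (ratNumDen.comp (fst _ _) :)
  have hb : CodeFP (pairE encodeRat encodeRat) (pairE intE natE) (fun p => (p.2.num, p.2.den)) :=
    (ratNumDen.comp (snd _ _) :)
  have h : CodeFP (pairE encodeRat encodeRat) bitE
      (fun p => decide (p.1.num * (p.2.den : ℤ) ≤ p.2.num * (p.1.den : ℤ))) :=
    (intLe.comp ((intMul.comp (ha.fst'.pair (intOfNat.comp hb.snd'))).pair
      (intMul.comp (hb.fst'.pair (intOfNat.comp ha.snd')))) :)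
  exact h.congr fun p => decide_eq_decide.2 (Rat.le_iff p.1 p.2).symm

/-- Comparison of rationals on codes (`<`). [cite: KnuthTAOCP2, §4.5.1] -/
theorem ratLt : CodeFP (pairE encodeRat encodeRat) bitE (fun p => decide (p.1 < p.2)) :=
  (not (ratLe.comp ((snd _ _).pair (fst _ _)))).congr fun p => by
    by_cases h : p.1 < p.2
    · simp [h, not_le.2 h]
    · simp [h, not_lt.1 h]

/-- `max` of rationals on codes. [folklore] -/
theorem ratMax : CodeFP (pairE encodeRat encodeRat) encodeRat (fun p => max p.1 p.2) :=
  (ratLe.ite (snd _ _) (fst _ _)).congr fun p => by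
    by_cases h : p.1 ≤ p.2
    · rw [decide_eq_true h]; simp [max_eq_right h]
    · rw [decide_eq_false h]; simp [max_eq_left (not_le.1 h).le]

/-- `min` of rationals on codes. [folklore] -/
theorem ratMin : CodeFP (pairE encodeRat encodeRat) encodeRat (fun p => min p.1 p.2) :=
  (ratLe.ite (fst _ _) (snd _ _)).congr fun p => by
    by_cases h : p.1 ≤ p.2
    · rw [decide_eq_true h]; simp [min_eq_left h]
    · rw [decide_eq_false h]; simp [min_eq_right (not_le.1 h).le]

/-! ### Floors -/

/-- **The natural floor of a rational on codes**: `⌊q⌋₊ = toNat (num q / den q)`. [cite: KnuthTAOCP2, §4.5.1] -/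
theorem ratNatFloor : CodeFP encodeRat natE (fun q : ℚ => ⌊q⌋₊) := by
  have h : CodeFP encodeRat natE (fun q : ℚ => (q.num / (q.den : ℤ)).toNat) :=
    (intToNat.comp (intEDiv.comp (ratNumDen.fst'.pair (intOfNat.comp ratNumDen.snd'))) :)
  exact h.congr fun q => by rw [← Rat.floor_def', Int.floor_toNat]

end CodeFP

end Literature.Computability.Complexity

/-! ### The sampler's arithmetic -/

namespace Literature.Computability.Cryptography

namespace GaussRejFP

open Literature.Computability.Complexity Literature.Computability.Complexity.CodeFP
  Literature.Computability.QuantumComplexity Literature.Probability.Distributions Literature.Probability.Distributions.GaussRej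
open Literature.Algebra.EuclideanLattices (encodeRat encodeRat_injective)

/-- **`clamp01` on codes.** [folklore] -/
theorem clamp01_codeFP : CodeFP encodeRat encodeRat clamp01 :=
  (ratMax.comp ((const _ (0 : ℚ)).pair (ratMin.comp ((const _ (1 : ℚ)).pair (CodeFP.id encodeRat))))).congr
    fun _ => rfl

/-- The Taylor term with the exponent capped at a unary budget (no cap takes effect for `i ≤ B`). [folklore] -/
theorem taylorTerm_codeFP :
    CodeFP (pairE (pairE encodeRat unE) natE) encodeRat
      (fun p => (-p.1.1) ^ (min p.2 p.1.2) / ((min p.2 p.1.2).factorial : ℚ)) := by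
  have hz : CodeFP (pairE (pairE encodeRat unE) natE) encodeRat (fun p => -p.1.1) :=
    ((ratMul.comp ((const _ (-1 : ℚ)).pair (fst _ _).fst')).congr fun p => by simp)
  have hi : CodeFP (pairE (pairE encodeRat unE) natE) unE (fun p => min p.2 p.1.2) :=
    (unOfNatMin.comp ((fst _ _).snd'.pair (snd _ _)) :)
  have hpow : CodeFP (pairE (pairE encodeRat unE) natE) encodeRat (fun p => (-p.1.1) ^ (min p.2 p.1.2)) :=
    (PowerSeriesFP.ratPow.comp (hz.pair hi) :)
  have hfac : CodeFP (pairE (pairE encodeRat unE) natE) encodeRat (fun p => ((min p.2 p.1.2).factorial : ℚ)) :=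
    ((ratOfIntNat.comp ((intOfNat.comp (natFactorial_codeFP.comp hi)).pair (const _ 1))).congr fun p => by simp)
  exact (ratDiv.comp (hpow.pair hfac) :)

/-- **`(z, 1ᴺ) ↦ taylorExpNeg z N = ∑_{i<N} (-z)ⁱ/i!` is polynomial time.** [cite: KnuthTAOCP2, §4.6.4 (evaluation of polynomials)] -/
theorem taylorExpNeg_codeFP : CodeFP (pairE encodeRat unE) encodeRat (fun p => taylorExpNeg p.1 p.2) := by
  have hmap := (map taylorTerm_codeFP).comp ((CodeFP.id (pairE encodeRat unE)).pair (urange.comp (snd _ _)))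
  refine ((ratSum.comp hmap).congr fun p => ?_)
  obtain ⟨z, N⟩ := p
  show (List.map _ (List.range N)).sum = taylorExpNeg z N
  unfold taylorExpNeg
  rw [← List.toFinset_range, List.sum_toFinset _ List.nodup_range]
  congr 1
  refine List.map_congr_left fun i hi => ?_
  rw [List.mem_range] at hi
  dsimp only [id_eq]
  rw [min_eq_left hi.le]

/-- **`((y, 1ˢ), (1ᴺ, 1^{pad})) ↦ clamp01(taylor(y/2ˢ))^{pad}`**; at `pad = 2ˢ` this is `expNegApprox y s N`.
[cite: KnuthTAOCP2, §4.6.3] -/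
theorem expNegApproxPad_codeFP :
    CodeFP (pairE (pairE encodeRat unE) (pairE unE unE)) encodeRat
      (fun p => clamp01 (taylorExpNeg (p.1.1 / 2 ^ p.1.2) p.2.1) ^ p.2.2) := by
  have h2s : CodeFP (pairE (pairE encodeRat unE) (pairE unE unE)) encodeRat (fun p => ((2 : ℚ) ^ p.1.2)) :=
    ((ratOfIntNat.comp ((intOfNat.comp (natPow.comp ((const _ 2).pair (fst _ _).snd'))).pair (const _ 1))).congr
      fun p => by simp)
  have hy : CodeFP (pairE (pairE encodeRat unE) (pairE unE unE)) encodeRat (fun p => p.1.1 / 2 ^ p.1.2) :=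
    (ratDiv.comp ((fst _ _).fst'.pair h2s) :)
  have ht : CodeFP (pairE (pairE encodeRat unE) (pairE unE unE)) encodeRat
      (fun p => clamp01 (taylorExpNeg (p.1.1 / 2 ^ p.1.2) p.2.1)) :=
    (clamp01_codeFP.comp (taylorExpNeg_codeFP.comp (hy.pair (snd _ _).fst')) :)
  exact (PowerSeriesFP.ratPow.comp (ht.pair (snd _ _).snd') :)

/-- The record of the acceptance arithmetic: `(θ, c, 1ˢ, 1ᴺ, 1ᴾ, 1^{2ˢ})`. [folklore] -/
abbrev AccCtx : Type := ℚ × ℚ × ℕ × ℕ × ℕ × ℕ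

/-- Its code. [folklore] -/
abbrev accCtxE : AccCtx → List Bool := pairE encodeRat (pairE encodeRat (pairE unE (pairE unE (pairE unE unE))))

/-- The record of the parameters `θ c s N P` (padding `2ˢ`). [folklore] -/
def accCtxOf (θ c : ℚ) (s N P : ℕ) : AccCtx := (θ, c, s, N, P, 2 ^ s)

/-- **The acceptance numerator against the record**: `⌊2ᴾ · clamp01(taylor(θ(x-c)²/2ˢ))^{pad}⌋₊`.
[cite: GentryPeikertVaikuntanathan2008, §4.1] -/
def accNumOf (r : AccCtx) (x : ℤ) : ℕ :=
  ⌊(2 : ℚ) ^ r.2.2.2.2.1 * clamp01 (taylorExpNeg (r.1 * ((x : ℚ) - r.2.1) ^ 2 / 2 ^ r.2.2.1) r.2.2.2.1) ^ r.2.2.2.2.2⌋₊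

/-- At the record of `θ c s N P` the numerator is `accNum`. [folklore] -/
theorem accNumOf_accCtxOf (θ c : ℚ) (s N P : ℕ) (x : ℤ) : accNumOf (accCtxOf θ c s N P) x = accNum θ c s N P x := rfl

/-- **`(record, x) ↦ accNumOf record x` is polynomial time.** [cite: GentryPeikertVaikuntanathan2008, §4.1; AroraBarak2009, §1.3] -/
theorem accNumOf_codeFP : CodeFP (pairE accCtxE intE) natE (fun p => accNumOf p.1 p.2) := by
  have hθ : CodeFP (pairE accCtxE intE) encodeRat (fun p => p.1.1) := (fst _ _).fst'
  have hc : CodeFP (pairE accCtxE intE) encodeRat (fun p => p.1.2.1) := (fst _ _).snd'.fst'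
  have hs : CodeFP (pairE accCtxE intE) unE (fun p => p.1.2.2.1) := (fst _ _).snd'.snd'.fst'
  have hN : CodeFP (pairE accCtxE intE) unE (fun p => p.1.2.2.2.1) := (fst _ _).snd'.snd'.snd'.fst'
  have hP : CodeFP (pairE accCtxE intE) unE (fun p => p.1.2.2.2.2.1) := (fst _ _).snd'.snd'.snd'.snd'.fst'
  have hpad : CodeFP (pairE accCtxE intE) unE (fun p => p.1.2.2.2.2.2) := (fst _ _).snd'.snd'.snd'.snd'.snd'
  have hx : CodeFP (pairE accCtxE intE) encodeRat (fun p => ((p.2 : ℤ) : ℚ)) :=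
    ((ratOfIntNat.comp ((snd _ _).pair (const _ 1))).congr fun p => by simp)
  have hd : CodeFP (pairE accCtxE intE) encodeRat (fun p => ((p.2 : ℤ) : ℚ) - p.1.2.1) :=
    ((ratAdd.comp (hx.pair (ratMul.comp ((const _ (-1 : ℚ)).pair hc)))).congr fun p => by simp; ring)
  have hy : CodeFP (pairE accCtxE intE) encodeRat (fun p => p.1.1 * (((p.2 : ℤ) : ℚ) - p.1.2.1) ^ 2) :=
    ((ratMul.comp (hθ.pair (ratMul.comp (hd.pair hd)))).congr fun p => by ring)
  have hE : CodeFP (pairE accCtxE intE) encodeRat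
      (fun p => clamp01 (taylorExpNeg (p.1.1 * (((p.2 : ℤ) : ℚ) - p.1.2.1) ^ 2 / 2 ^ p.1.2.2.1) p.1.2.2.2.1) ^ p.1.2.2.2.2.2) :=
    (expNegApproxPad_codeFP.comp ((hy.pair hs).pair (hN.pair hpad)) :)
  have h2P : CodeFP (pairE accCtxE intE) encodeRat (fun p => ((2 : ℚ) ^ p.1.2.2.2.2.1)) :=
    ((ratOfIntNat.comp ((intOfNat.comp (natPow.comp ((const _ 2).pair hP))).pair (const _ 1))).congr fun p => by simp)
  exact (ratNatFloor.comp (ratMul.comp (h2P.pair hE))).congr fun p => rfl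

end GaussRejFP

end Literature.Computability.Cryptography
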